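import Literature.MathematicalPhysics.QuantumFieldTheory.Balaban1983to89.T3Thresholds
import Literature.MathematicalPhysics.QuantumFieldTheory.Balaban1983to89.T3InteriorExcision
import Literature.MathematicalPhysics.QuantumFieldTheory.Balaban1983to89.BlockAveragingPlaquetteBound
import Literature.MathematicalPhysics.QuantumFieldTheory.Balaban1983to89.T3UnitLawDensityEML
import HarnessLib

/-!
# THE ONE-STEP WINDOW of route `FirstExitWindow` (support item stmt-QuantumFields-26244 `OneStepWindowL`) — BODY, route-independent

Seat `ym-line-sfw-p1` g11 (home cell `ym-idea-1`), `--supports stmt-QuantumFields-26244`.  The by-name closing theorem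
(`… : Theses.FirstExitWindow.OneStepWindowL`) lives in the twin file `FirstExitWindowOneStepWindowL.lean`; THIS file imports NO route
file, so consumers (the glue `HistoryTailOfFirstExit`, r3 certificates on `SmallFieldWidening`) may import it without entering a theses cone.

THE STATEMENT (`oneStepWindow`): for every block size `L` and profile `(b₀, p₀)` (`0 < b₀`, `2 < p₀`) there are a wider constant
`b₂ ≥ b₀` and a coupling threshold `γ₁ ∈ (0,1]` such that for every d = 3 family `F` with `F.L = L`, every `0 < γ ≤ γ₁`, every cut-off `K`,
every level `j` with `j + 1 ≤ K` and EVERY configuration `U`: if all plaquette variables of the `j`-fold (0.4)-average `Ū^{(j)}` are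
`θ_{b₀}(K − j)`-small, then all plaquette variables of `Ū^{(j+1)}` are `θ_{b₂}(K − (j+1))`-small — with the tree's thresholds
`θ_{b}(h) = θBal L γ b p₀ h = g_h·b(1 + log g_h⁻¹)^{p₀}`, `g_h = √(γL^{−h})` ([Balaban1985UV3] (7) p.257).

THE PROOF (deterministic, three tree facts):
* [Balaban1985Averaging] Prop. 1 in the crude form PROVED in the tree for the (0.4)/`exp[mean log]` averaging `ℰp`
  (`BlockAveragingPlaquetteBound.plaqSmall_blockAvg_expMeanLogSU`): `PlaqSmall a V ⇒ PlaqSmall (A·a) (blockAvg ℰp V)` at EVERY level `j`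
  (`j + 1 ≤ m + K`), `A = L² + 6((d+2)L)²`, under the guard `(((d+2)L)²/4)·a < δ_{SU(2)}`;
* the guard for `a = θ_{b₀}(K − j)` at every height once `γ ≤ γ₁`: `T3Thresholds.exists_gamma_forall_θBal_le` (thresholds are uniformly small);
* the transport of thresholds one level up: `θ_{b₀}(h) ≤ θ_{b₀}(h − 1)` (`T3Thresholds.θBal_le_of_le`, antitone once `√γ ≤ e^{1−p₀}`,
  i.e. `γ ≤ e^{2(1−p₀)}`) and linearity in the profile constant (`T3InteriorExcision.θBal_mul`): `A·θ_{b₀}(h) ≤ θ_{A·b₀}(h−1)`.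
Hence `b₂ = max 1 A · b₀` and `γ₁ = min γ_θ e^{2(1−p₀)}` do it (the informal's sharper `b₂ ∝ L^{3/2}(1+½log L)^{p₀}` is not needed:
antitonicity of `θ` already absorbs the level shift).  Degenerate `L = 0` (no family has `F.L = 0 < 2`): `b₂ = b₀`, `γ₁ = 1`, vacuous.

HONEST FRAMING.  A kernel fact about the tree's own averaging and thresholds — the «near miss» of route `FirstExitWindow` made a window;
NOTHING probabilistic, nothing of Bałaban's estimates asserted; rung R3 is a RECORD rung and no summit / Clay statement is touched.
No `def`, no named fact, no `sorry`.

References: T. Bałaban, CMP **98** (1985) 17–51 [Balaban1985Averaging] (Prop. 1 (51) p.26); CMP **102** (1985) 255–275 [Balaban1985UV3]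
((7) p.257); CMP **109** (1987) 249–301 [Balaban1987RG1] ((0.4) p.253).
-/

noncomputable section

namespace Summit.QuantumFields.YangMills.Theorems.FirstExitWindow

open Literature.MathematicalPhysics.QuantumFieldTheory.Balaban1983to89
open Literature.MathematicalPhysics.QuantumFieldTheory.Balaban1983to89.T3ContinuumYM3Torus
open Literature.MathematicalPhysics.QuantumFieldTheory.Balaban1983to89.T3UnitScaleTilt (θBal)
open Literature.MathematicalPhysics.QuantumFieldTheory.Balaban1983to89.T3UnitLawDensityEML (ℰp)
open Literature.MathematicalPhysics.QuantumFieldTheory.Balaban1983to89.ExpMeanLog (expMeanLogSU deltaSU deltaSU_pos)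
open Literature.MathematicalPhysics.QuantumFieldTheory.Balaban1983to89.BlockAveraging (blockAvg)
open Literature.MathematicalPhysics.QuantumFieldTheory.Balaban1983to89.BlockAveragingPlaquetteBound (plaqSmall_blockAvg_expMeanLogSU)
open Literature.MathematicalPhysics.QuantumFieldTheory.Balaban1983to89.T3Thresholds (exists_gamma_forall_θBal_le θBal_le_of_le sqrt_le_exp_iff)
open Literature.MathematicalPhysics.QuantumFieldTheory.Balaban1983to89.T3MinimiserStabilityReduction (θBal_pos)
open Literature.MathematicalPhysics.QuantumFieldTheory.Balaban1983to89.T3InteriorExcision (θBal_mul)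

/-- ★ **ONE (0.4)-AVERAGING STEP AT THE ROUTE'S THRESHOLDS, EVERY LEVEL**: for `0 < γ ≤ γ_θ` (the threshold of
`exists_gamma_forall_θBal_le` at `σ = δ_{SU(2)}/(5L)²`), `γ ≤ 1`, `j + 1 ≤ m + K`, a level-`j` field all of whose plaquettes are `θ_{b₀}(h)`-small
averages into a field all of whose plaquettes are `(L² + 6(5L)²)·θ_{b₀}(h)`-small ([Balaban1985Averaging] Prop. 1, crude form, tree
`plaqSmall_blockAvg_expMeanLogSU`). [cite: Balaban1985Averaging, Prop. 1 (51) p.26] -/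
theorem plaqSmall_blockAvg_θBal (F : T3Family) {γ b₀ p₀ : ℝ} (hγ : 0 < γ) (hγ1 : γ ≤ 1) (hb : 0 < b₀)
    (hθ : ∀ i : ℕ, θBal F.L γ b₀ p₀ i ≤ deltaSU (Fin 2) / (((3 + 2) * F.L : ℕ) : ℝ) ^ 2)
    (K j : ℕ) (hj : j + 1 ≤ F.m + K) (h : ℕ)
    (V : GaugeField (F.P K) j (Matrix.specialUnitaryGroup (Fin 2) ℂ)) (hV : PlaqSmall (θBal F.L γ b₀ p₀ h) V) :
    PlaqSmall (((F.L : ℝ) ^ 2 + 6 * (((3 + 2) * F.L : ℕ) : ℝ) ^ 2) * θBal F.L γ b₀ p₀ h)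
      ((blockAvg (P := F.P K) (j := j) ℰp).avg V) := by
  have hL : 1 ≤ F.L := le_of_lt F.hL.2
  have hθ0 : 0 ≤ θBal F.L γ b₀ p₀ h := (θBal_pos hL hγ hγ1 hb p₀ h).le
  -- the guard `((5L)²/4)·θ < δ`
  have h5 : (0 : ℝ) < (((3 + 2) * F.L : ℕ) : ℝ) := by exact_mod_cast (by omega : 0 < (3 + 2) * F.L)
  have hδ : 0 < deltaSU (Fin 2) := deltaSU_pos
  have hguard : (((3 + 2) * F.L : ℕ) : ℝ) ^ 2 / 4 * θBal F.L γ b₀ p₀ h < deltaSU (Fin 2) := by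
    calc (((3 + 2) * F.L : ℕ) : ℝ) ^ 2 / 4 * θBal F.L γ b₀ p₀ h
        ≤ (((3 + 2) * F.L : ℕ) : ℝ) ^ 2 / 4 * (deltaSU (Fin 2) / (((3 + 2) * F.L : ℕ) : ℝ) ^ 2) :=
          mul_le_mul_of_nonneg_left (hθ h) (by positivity)
      _ = deltaSU (Fin 2) / 4 := by field_simp
      _ < deltaSU (Fin 2) := by linarith
  have hjP : j + 1 ≤ (F.P K).m + (F.P K).K := by show j + 1 ≤ F.m + K; exact hj
  have hguardP : (((((F.P K).d + 2) * (F.P K).L : ℕ) : ℝ) ^ 2 / 4) * θBal F.L γ b₀ p₀ h < deltaSU (Fin 2) := by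
    rw [T3Family.P_d]; exact hguard
  have hmain := plaqSmall_blockAvg_expMeanLogSU (n := Fin 2) (P := F.P K) (j := j) hjP hθ0 hV hguardP
  rw [T3Family.P_d] at hmain
  exact hmain

/-- ★★ **THE ONE-STEP WINDOW** (body of `Theses.FirstExitWindow.OneStepWindowL`, stmt-QuantumFields-26244): `∀ L b₀ p₀ (0 < b₀, 2 < p₀)
∃ b₂ ≥ b₀, γ₁ ∈ (0,1]` such that for every family `F` with `F.L = L`, every `0 < γ ≤ γ₁`, every `K`, every `j` with `j + 1 ≤ K` and every
configuration `U`: `PlaqSmall θ_{b₀}(K − j) (Ū^{(j)}) → PlaqSmall θ_{b₂}(K − (j+1)) (Ū^{(j+1)})`.  Witnesses: `b₂ = max 1 (L² + 6(5L)²)·b₀`,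
`γ₁ = min γ_θ e^{2(1−p₀)}`. [cite: Balaban1985Averaging, Prop. 1 (51) p.26] -/
theorem oneStepWindow :
    ∀ (L : ℕ) (b₀ p₀ : ℝ), 0 < b₀ → 2 < p₀ → ∃ (b₂ γ₁ : ℝ), b₀ ≤ b₂ ∧ 0 < γ₁ ∧ γ₁ ≤ 1 ∧
      ∀ (F : T3Family) (γ : ℝ), F.L = L → 0 < γ → γ ≤ γ₁ → ∀ (K j : ℕ), j + 1 ≤ K →
        ∀ U : GaugeField (F.P K) 0 (Matrix.specialUnitaryGroup (Fin 2) ℂ),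
          PlaqSmall (θBal F.L γ b₀ p₀ (K - j)) (Averaging.iter (fun i => blockAvg (P := F.P K) (j := i) ℰp) j U) →
          PlaqSmall (θBal F.L γ b₂ p₀ (K - (j + 1))) (Averaging.iter (fun i => blockAvg (P := F.P K) (j := i) ℰp) (j + 1) U) := by
  intro L b₀ p₀ hb₀ hp₀
  by_cases hL : 1 ≤ L
  swap
  · -- degenerate block size: no family has `F.L = L ≤ 0`
    refine ⟨b₀, 1, le_rfl, one_pos, le_rfl, ?_⟩
    intro F γ hFL
    exact absurd (hFL ▸ le_of_lt F.hL.2) hL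
  -- the window constant and the coupling threshold
  set A : ℝ := (L : ℝ) ^ 2 + 6 * (((3 + 2) * L : ℕ) : ℝ) ^ 2 with hA
  have hA1 : 1 ≤ max 1 A := le_max_left _ _
  have hA0 : 0 < max 1 A := one_pos.trans_le hA1
  have h5 : (0 : ℝ) < (((3 + 2) * L : ℕ) : ℝ) := by exact_mod_cast (by omega : 0 < (3 + 2) * L)
  have hσ : 0 < deltaSU (Fin 2) / (((3 + 2) * L : ℕ) : ℝ) ^ 2 := div_pos deltaSU_pos (by positivity)
  obtain ⟨γθ, hγθ, hγθ1, hθ⟩ := exists_gamma_forall_θBal_le hb₀ (by linarith : (0 : ℝ) < p₀) hσ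
  refine ⟨max 1 A * b₀, min γθ (Real.exp (2 * (1 - p₀))), ?_, lt_min hγθ (Real.exp_pos _), (min_le_left _ _).trans hγθ1, ?_⟩
  · exact le_mul_of_one_le_left hb₀.le hA1
  intro F γ hFL hγ hγ₁ K j hjK U hU
  subst hFL
  have hγθ' : γ ≤ γθ := hγ₁.trans (min_le_left _ _)
  have hγ1 : γ ≤ 1 := hγθ'.trans hγθ1
  have hγe : Real.sqrt γ ≤ Real.exp (1 - p₀) := (sqrt_le_exp_iff hγ.le).mpr (hγ₁.trans (min_le_right _ _))
  -- one averaging step at level `j` (Prop. 1, crude form) on `V = Ū^{(j)}`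
  have hstep := plaqSmall_blockAvg_θBal F hγ hγ1 hb₀ (fun i => hθ F.L hL γ hγ hγθ' i) K j (by have := F.hm; omega) (K - j)
    (Averaging.iter (fun i => blockAvg (P := F.P K) (j := i) ℰp) j U) hU
  -- `Ū^{(j+1)} = blockAvg_j (Ū^{(j)})` by `rfl`; thresholds: `A·θ_{b₀}(K−j) ≤ max 1 A · θ_{b₀}(K−(j+1)) = θ_{b₂}(K−(j+1))`
  show PlaqSmall (θBal F.L γ (max 1 A * b₀) p₀ (K - (j + 1))) ((blockAvg (P := F.P K) (j := j) ℰp).avg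
    (Averaging.iter (fun i => blockAvg (P := F.P K) (j := i) ℰp) j U))
  have hθ0 : 0 ≤ θBal F.L γ b₀ p₀ (K - j) := (θBal_pos hL hγ hγ1 hb₀ p₀ (K - j)).le
  have hanti : θBal F.L γ b₀ p₀ (K - j) ≤ θBal F.L γ b₀ p₀ (K - (j + 1)) :=
    θBal_le_of_le hL hγ hγ1 hγe hb₀.le (by linarith) (by omega)
  have hle : A * θBal F.L γ b₀ p₀ (K - j) ≤ θBal F.L γ (max 1 A * b₀) p₀ (K - (j + 1)) := by
    rw [θBal_mul]
    calc A * θBal F.L γ b₀ p₀ (K - j) ≤ max 1 A * θBal F.L γ b₀ p₀ (K - j) := mul_le_mul_of_nonneg_right (le_max_right _ _) hθ0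
      _ ≤ max 1 A * θBal F.L γ b₀ p₀ (K - (j + 1)) := mul_le_mul_of_nonneg_left hanti hA0.le
  exact fun p => (hstep p).trans_le hle

end Summit.QuantumFields.YangMills.Theorems.FirstExitWindow

end
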